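import Mathlib
import HarnessLib
import Summits.ValiantsHypothesis.ValiantsHypothesis.Theses.MonotoneRestoration
import Summits.ValiantsHypothesis.ValiantsHypothesis.Theorems.MonotoneRestorationWidthKillsRestoration
import Summits.ValiantsHypothesis.ValiantsHypothesis.Theorems.MonotoneRestorationTargetImpliesCrux
import Summits.ValiantsHypothesis.ValiantsHypothesis.Theorems.MonotoneRestorationMonotoneRestorationQPEpsilonComplex
import Literature.ModelTheory.FiniteModelTheory.CkEquiv
import Literature.ModelTheory.FiniteModelTheory.SymmetricCircuitCountingWidthProofs
import Literature.Computability.AlgebraicComplexity.SymmetricThresholdTranslation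

/-!
# Route MonotoneRestoration, crux `MonotoneRestorationQP` — `¬ L1` (orbit-form restoration) MODULO a
# polylog-width VP family (refuter, crux-attack `mr-refute-l1-width`, 2026-08-17)

Line Sketch v10 / `orbit-compression` cuts the crux `stmt-ValiantsHypothesis-15886` into
L1 = `stub_orbitRestoration` (every matrix-symmetric `VP` family over `ℂ` has square-symmetric circuits
of quasi-polynomial ORBIT size; ALONE decides the summit, `orbitRestoration_decides`) and
L2 = `stub_orbitCompression`.  The route's landed kill glue `widthKillsRestoration_proof`
(`PolylogWidthMonotoneEasy → ¬ MonotoneRestorationQP`) is a SIZE-form statement about the monotone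
crux.  This file records the ORBIT-form kill glue against L1 itself, in the `VP` dress that
THEOREM ε (`monotoneRestorationQP_iff_complexRestorationQP`) certifies to be the real content:

* L1 is quoted INLINE in the theorem types (verbatim from Cruxes/MonotoneRestorationQP/Lines/Sketch.lean:81–90;
  the only `def` of this file is the hypothesis `H`);
* `PolylogWidthVP` — THE MISSING CONSTRUCTION `H`: a matrix-symmetric `VP`
  family over `ℂ` whose values at `0/1` adjacency matrices separate, for every level `c` and beyond
  every order `N`, two `≡^{C^{(log₂ m + c)^c}}`-equivalent graphs on `Fin m` (counting width
  `ω(polylog)`; Dwivedi–Pago–Seppelt 2026 Outlook Q3 answered "yes" at quasi-polynomial scale; an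
  "arithmetic CFI family in characteristic 0" — no example is known, Dawar–Wilsenach 2025 §8);
* `not_qpOrbitSymmetric_of_polylogSeparating` — the engine, for ANY complex family: a
  polylog-separating family has no square-symmetric circuits of ORBIT size `2^{(log₂ n + c)^c}`
  (Dawar–Wilsenach Thm 5.1 threshold translation `thresholdCircuit_orbitSize_le`, reduced
  rigidification with the Support Theorem `exists_reduced_rigidification_supports`, Anderson–Dawar
  per-order lemma `eval_adjInput_eq_of_ckEquiv`; the pipeline of `widthKillsRestoration_proof` with the
  size bound replaced by the orbit bound it was only ever used through);
* `stub_orbitRestoration_false_of_polylogWidthVP : PolylogWidthVP → ¬ L1`;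
* `monotoneRestorationQP_implies_orbitRestoration` (crux ⇒ L1, via THEOREM ε and
  `orbitSize ≤ size`), hence `monotoneRestorationQP_false_of_polylogWidthVP` and
  `nonnegRestorationQP_false_of_polylogWidthVP` (target ⇒ crux, `stub_target_implies_crux`);
* `polylogWidthVP_of_polylogWidthMonotoneEasy` — the route's own kill witness (item
  stmt-ValiantsHypothesis-17619) implies `H` (complexify), so `H` is the WEAKEST typed kill hypothesis
  in the cone, and `stub_orbitRestoration_false_of_polylogWidthMonotoneEasy` is the orbit-strength form
  of `WidthKillsRestoration`.

Everything here is proved; L1 and the crux stay open (this is `¬ L1` modulo the construction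
`PolylogWidthVP`).  Refuter census of attempted constructions: Cruxes/MonotoneRestorationQP/Disproof.lean,
section `L1`.
-/

noncomputable section

-- `Summit.ValiantsHypothesis.ValiantsHypothesis.…` is the tree's mandated namespace (Sub = Summit).
set_option linter.dupNamespace false

namespace Summit.ValiantsHypothesis.ValiantsHypothesis.Theorems

open Summit.ValiantsHypothesis.ValiantsHypothesis.Theses.MonotoneRestoration
open Literature.Computability.AlgebraicComplexity
open Literature.Computability.Complexity
open Literature.ModelTheory.FiniteModelTheory

/-- **`H` = POLYLOG-WIDTH VP FAMILY** — the construction a counting-width refutation of L1 needs: a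
matrix-symmetric (`S_n × S_n`-invariant) `VP` family over `ℂ` that is POLYLOG-SEPARATING: for every level `c`
and beyond every order `N` there are `m ≥ N` and two `≡^{C^{(log₂ m + c)^c}}`-equivalent graphs on `Fin m`
whose `0/1` adjacency matrices get different values of `f m` (counting width `ω(polylog)`, the separation form
of the route's kill witness `PolylogWidthMonotoneEasy`).  A "yes" to
Dwivedi–Pago–Seppelt 2026 Outlook Q3 with treewidth growing faster than polylog; an arithmetic
Cai–Fürer–Immerman family in characteristic `0`.  No example is known (the permanent separates at
LINEAR level, Dawar–Wilsenach Thm 7.2, but `per ∈ VP` is `¬VH`).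
[conjecture-grade: DwivediPagoSeppelt2026 Outlook Q3; DawarWilsenach2025 §8 p. 29] -/
def PolylogWidthVP : Prop :=
  ∃ f : (n : ℕ) → MvPolynomial (Fin n × Fin n) ℂ,
    (∀ (n : ℕ) (σ τ : Equiv.Perm (Fin n)),
      MvPolynomial.rename (fun p : Fin n × Fin n => (σ p.1, τ p.2)) (f n) = f n) ∧
    IsVPFamily f ∧
    ∀ c N : ℕ, ∃ m : ℕ, N ≤ m ∧ ∃ X Y : SimpleGraph (Fin m),
      CkEquiv ((Nat.log 2 m + c) ^ c) X Y ∧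
        MvPolynomial.eval (Set.indicator {ij : Fin m × Fin m | X.Adj ij.1 ij.2} 1) (f m) ≠
          MvPolynomial.eval (Set.indicator {ij : Fin m × Fin m | Y.Adj ij.1 ij.2} 1) (f m)

/-- **The engine (orbit form of the kill pipeline).** A polylog-separating complex family has NO
square-symmetric circuits of quasi-polynomial ORBIT size.  Per order `m`: the circuit `C_m` of orbit
size `≤ 2^{(log₂ m + c')^{c'}}` becomes a square-symmetric threshold circuit deciding "value `=` value
at `X`" of orbit size `+ m² + 1` (Dawar–Wilsenach Thm 5.1), then a reduced rigidification of orbit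
size `+ m²` whose gates have supports of size `≤ k = (log₂ m + c₃)^{c₃}` as soon as the orbit size is
`≤ 2^k ≤ C(m, k)` and `8k < m` (Support Theorem), and supports of size `≤ k` force equal outputs on the
`≡^{C^{2k+2}}`-equivalent witness pair (Anderson–Dawar), contradicting the separation.  Identical to
`widthKillsRestoration_proof` except that the orbit bound enters directly instead of through
`orbitSize ≤ size`. [cite: DawarWilsenach2025, Thm 5.1, §6, §7.1; AndersonDawar2016, Thm 6] -/
theorem not_qpOrbitSymmetric_of_polylogSeparating (f : (n : ℕ) → MvPolynomial (Fin n × Fin n) ℂ)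
    (hsep : (∀ c N : ℕ, ∃ m : ℕ, N ≤ m ∧ ∃ X Y : SimpleGraph (Fin m),
        CkEquiv ((Nat.log 2 m + c) ^ c) X Y ∧
          MvPolynomial.eval (Set.indicator {ij : Fin m × Fin m | X.Adj ij.1 ij.2} 1) (f m) ≠
            MvPolynomial.eval (Set.indicator {ij : Fin m × Fin m | Y.Adj ij.1 ij.2} 1) (f m))) :
    ¬ ∃ c : ℕ, ∀ n : ℕ, ∃ (G : Type) (_ : Fintype G)
      (C : LabelledArithCircuit ℂ (Fin n × Fin n) Unit G),
      C.IsSymmetric (Equiv.Perm (Fin n)) ∧ C.eval (C.output ()) = f n ∧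
        C.orbitSize (Equiv.Perm (Fin n)) ≤ 2 ^ ((Nat.log 2 n + c) ^ c) := by
  rintro ⟨c', hc'⟩
  classical
  -- bookkeeping exponent: `2^((L+c')^c') + (m+2)^2 + m*m + 16 ≤ 2^((L+c₃)^c₃)`
  obtain ⟨c₃, hc₃⟩ := monotoneRestoration_cruxToTarget_size_le 2 c'
  -- the order threshold: `(L + c₃)^c₃ < m/8` for `m ≥ 2^k₀`
  obtain ⟨k₀, hk₀⟩ := symmetricLB_logPow_lt c₃ (δ := 1 / 8) (by norm_num)
  -- the witness pair at level `(L + (c₃+2))^(c₃+2)`, of order `m ≥ 2^k₀`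
  obtain ⟨m, hNm, X, Y, hXY, hne⟩ := hsep (c₃ + 2) (2 ^ k₀)
  obtain ⟨G, inst, C, hCsym, hCeval, hCorb⟩ := hc' m
  -- the support size `k`
  obtain ⟨k, hk⟩ : ∃ k : ℕ, k = (Nat.log 2 m + c₃) ^ c₃ := ⟨_, rfl⟩
  have hkR : (k : ℝ) = ((Nat.log 2 m : ℝ) + c₃) ^ c₃ := by
    rw [hk, Nat.cast_pow, Nat.cast_add]
  -- `m` is large: `8k < m`
  have h8k : 8 * k < m := by
    have h := hk₀ m hNm
    have h' : ((8 * k : ℕ) : ℝ) < (m : ℝ) := by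
      push_cast
      rw [hkR]
      linarith
    exact_mod_cast h'
  have hk1 : 1 ≤ k := by
    rcases Nat.eq_zero_or_pos c₃ with h0 | hpos
    · simp [hk, h0]
    · rw [hk]
      exact Nat.one_le_pow _ _ (by omega)
  have hm8 : 8 < m := by omega
  have hk4 : k + 1 ≤ m / 4 := (Nat.le_div_iff_mul_le (by norm_num)).2 (by omega)
  have h2k : 2 * k ≤ m := by omega
  -- the value of the circuit polynomial at (the adjacency matrix of) `X`
  obtain ⟨vX, hvX⟩ : ∃ v : ℂ, v = MvPolynomial.eval
      (fun ij => if adjInput X ij = true then (1 : ℂ) else 0) (C.eval (C.output ())) := ⟨_, rfl⟩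
  -- Dawar–Wilsenach Thm 5.1: the symmetric threshold circuit deciding "value `= vX`"
  obtain ⟨Ψ, hΨ⟩ : ∃ Ψ : Circuit (Fin m × Fin m), Ψ = C.thresholdCircuit ({vX} : Set ℂ) :=
    ⟨_, rfl⟩
  have hΨB : Ψ.IsOver tcBasis := by
    rw [hΨ]
    exact C.thresholdCircuit_isOver _
  have hΨsym : Ψ.IsSymmetricUnder Set.univ := by
    rw [hΨ]
    exact C.thresholdCircuit_isSymmetricUnder _ hCsym
  have hΨeval : ∀ A : Fin m × Fin m → Bool, Ψ.eval A = true ↔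
      MvPolynomial.eval (fun ij => if A ij = true then (1 : ℂ) else 0) (C.eval (C.output ())) ∈
        ({vX} : Set ℂ) := by
    intro A
    rw [hΨ]
    exact C.thresholdCircuit_eval _ A
  have hΨorb : Ψ.orbitSize Set.univ ≤ C.orbitSize (Equiv.Perm (Fin m)) + m ^ 2 + 1 := by
    rw [hΨ]
    exact C.thresholdCircuit_orbitSize_le _ hCsym
  -- reduced rigidification with the Support Theorem attached
  obtain ⟨C', hC'B, hC'sym, hC'eval, hC'orb, hC'supp⟩ :=
    exists_reduced_rigidification_supports Ψ hΨB hΨsym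
  have horbk : C'.orbitSize Set.univ ≤ m.choose k := by
    have hmm : m ^ 2 = m * m := sq m
    have hm2 : (m + 2) ^ 2 = m * m + 4 * m + 4 := by ring
    calc C'.orbitSize Set.univ
        ≤ 2 ^ ((Nat.log 2 m + c') ^ c') + (m + 2) ^ 2 + m * m + 16 := by omega
      _ ≤ 2 ^ ((Nat.log 2 m + c₃) ^ c₃) := hc₃ m
      _ = 2 ^ k := by rw [hk]
      _ ≤ m.choose k := two_pow_le_choose_of_two_mul_le h2k
  have hsupp := hC'supp hm8 k hk1 hk4 horbk
  -- Anderson–Dawar: equal outputs on the `C^{2k+2}`-equivalent witness pair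
  have hXY' : CkEquiv (2 * k + 2) X Y := by
    refine hXY.mono ?_
    rw [hk]
    exact widthKillsRestoration_level_le _ _
  have heq : C'.eval (adjInput X) = C'.eval (adjInput Y) :=
    eval_adjInput_eq_of_ckEquiv hC'B hC'sym hsupp hXY'
  -- read back through `Ψ`: the value at `Y` lies in `{vX}`
  have hX : Ψ.eval (adjInput X) = true := by
    rw [hΨeval, hvX]
    exact Set.mem_singleton _
  have hY : Ψ.eval (adjInput Y) = true := by
    rw [← hC'eval, ← heq, hC'eval]
    exact hX
  rw [hΨeval, Set.mem_singleton_iff, hvX, hCeval] at hY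
  -- Boolean inputs are the indicators of the statement; contradiction with the separation
  apply hne
  have hind : ∀ Γ : SimpleGraph (Fin m),
      Set.indicator {ij : Fin m × Fin m | Γ.Adj ij.1 ij.2} (1 : Fin m × Fin m → ℂ) =
        fun ij : Fin m × Fin m => if adjInput Γ ij = true then (1 : ℂ) else 0 := by
    intro Γ
    funext ij
    by_cases h : Γ.Adj ij.1 ij.2 <;> simp [h, adjInput_apply]
  rw [hind X, hind Y]
  exact hY.symm

/-- **`PolylogWidthVP → ¬ L1`** (L1 = `stub_orbitRestoration` of line Sketch v10, quoted verbatim; refuted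
MODULO the construction): orbit-form restoration would give
the polylog-width `VP` family square-symmetric circuits of quasi-polynomial orbit size, which the
engine forbids. [folklore] -/
theorem stub_orbitRestoration_false_of_polylogWidthVP : PolylogWidthVP →
    ¬ (∀ f : (n : ℕ) → MvPolynomial (Fin n × Fin n) ℂ,
      (∀ (n : ℕ) (σ τ : Equiv.Perm (Fin n)),
        MvPolynomial.rename (fun p : Fin n × Fin n => (σ p.1, τ p.2)) (f n) = f n) →
      IsVPFamily f →
      ∃ c : ℕ, ∀ n : ℕ, ∃ (G : Type) (_ : Fintype G)
        (C : LabelledArithCircuit ℂ (Fin n × Fin n) Unit G),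
        C.IsSymmetric (Equiv.Perm (Fin n)) ∧ C.eval (C.output ()) = f n ∧
          C.orbitSize (Equiv.Perm (Fin n)) ≤ 2 ^ ((Nat.log 2 n + c) ^ c)) := by
  rintro ⟨f, hsymm, hVP, hsep⟩ hL1
  exact not_qpOrbitSymmetric_of_polylogSeparating f hsep (hL1 f hsymm hVP)

/-- **crux ⇒ L1** (an orbit is a set of gates: `orbitSize ≤ size`; the complex form of the crux is
THEOREM ε, `monotoneRestorationQP_iff_complexRestorationQP`).  Same term as
`crux_implies_orbitRestoration` of the line skeleton, recorded in the tree. [folklore] -/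
theorem monotoneRestorationQP_implies_orbitRestoration :
    MonotoneRestorationQP → (∀ f : (n : ℕ) → MvPolynomial (Fin n × Fin n) ℂ,
      (∀ (n : ℕ) (σ τ : Equiv.Perm (Fin n)),
        MvPolynomial.rename (fun p : Fin n × Fin n => (σ p.1, τ p.2)) (f n) = f n) →
      IsVPFamily f →
      ∃ c : ℕ, ∀ n : ℕ, ∃ (G : Type) (_ : Fintype G)
        (C : LabelledArithCircuit ℂ (Fin n × Fin n) Unit G),
        C.IsSymmetric (Equiv.Perm (Fin n)) ∧ C.eval (C.output ()) = f n ∧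
          C.orbitSize (Equiv.Perm (Fin n)) ≤ 2 ^ ((Nat.log 2 n + c) ^ c)) := by
  intro h f hs hVP
  obtain ⟨c, hc⟩ := monotoneRestorationQP_iff_complexRestorationQP.mp h f hs hVP
  refine ⟨c, fun n => ?_⟩
  obtain ⟨G, inst, C, hsym, hev, hcard⟩ := hc n
  exact ⟨G, inst, C, hsym, hev, le_trans (C.orbitSize_le_size (Equiv.Perm (Fin n))) hcard⟩

/-- **`PolylogWidthVP → ¬ MonotoneRestorationQP`** — the crux refuted modulo the construction, in
`VP` dress (compare the route's `widthKillsRestoration_proof`, monotone dress, size form). [folklore] -/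
theorem monotoneRestorationQP_false_of_polylogWidthVP :
    PolylogWidthVP → ¬ MonotoneRestorationQP := fun hH hcrux =>
  stub_orbitRestoration_false_of_polylogWidthVP hH (monotoneRestorationQP_implies_orbitRestoration hcrux)

/-- **`PolylogWidthVP → ¬ NonnegRestorationQP`** — the target dies with the crux
(`stub_target_implies_crux`). [folklore] -/
theorem nonnegRestorationQP_false_of_polylogWidthVP :
    PolylogWidthVP → ¬ NonnegRestorationQP := fun hH hX =>
  monotoneRestorationQP_false_of_polylogWidthVP hH (stub_target_implies_crux hX)

/-- **The route's kill witness implies `H`.**  A monotone-easy nonnegative matrix-symmetric family of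
polynomial degree whose complexification is polylog-separating complexifies to a polylog-width `VP`
family (`n²` variables, degree and complexity `≤ n^{c'} + c'`; mapping a circuit along a ring hom does
not increase size, `ArithCircuit.complexity_map_le`).  So `PolylogWidthVP` is the weakest typed kill
hypothesis in the cone. [folklore] -/
theorem polylogWidthVP_of_polylogWidthMonotoneEasy : PolylogWidthMonotoneEasy → PolylogWidthVP := by
  rintro ⟨f, hsymm, ⟨c, hc⟩, hsep⟩
  refine ⟨fun n => MvPolynomial.map (Complex.ofRealHom.comp NNReal.toRealHom) (f n), ?_,
    ⟨⟨⟨2, fun n => ?_⟩, ⟨2 * c + 3 ^ c, fun n => ?_⟩⟩, ⟨2 * c + 3 ^ c, fun n => ?_⟩⟩, ?_⟩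
  · intro n σ τ
    rw [← MvPolynomial.map_rename, hsymm n σ τ]
  · simp only [Fintype.card_prod, Fintype.card_fin]
    nlinarith
  · calc (MvPolynomial.map (Complex.ofRealHom.comp NNReal.toRealHom) (f n)).totalDegree
        ≤ (f n).totalDegree := Finset.sup_mono (MvPolynomial.support_map_subset _ _)
      _ ≤ (n + 2) ^ c := (hc n).1
      _ ≤ n ^ (2 * c + 3 ^ c) + (2 * c + 3 ^ c) := targetImpliesCrux_pow_bound n c
  · calc complexity (MvPolynomial.map (Complex.ofRealHom.comp NNReal.toRealHom) (f n))
        ≤ complexity (f n) := ArithCircuit.complexity_map_le _ _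
      _ ≤ (n + 2) ^ c := (hc n).2
      _ ≤ n ^ (2 * c + 3 ^ c) + (2 * c + 3 ^ c) := targetImpliesCrux_pow_bound n c
  · intro c' N
    obtain ⟨m, hNm, X, Y, hXY, hne⟩ := hsep c' N
    exact ⟨m, hNm, X, Y, hXY, hne⟩

/-- **Orbit-strength form of `WidthKillsRestoration`**: the route's kill witness already refutes L1
(not only the size-form crux). [folklore] -/
theorem stub_orbitRestoration_false_of_polylogWidthMonotoneEasy :
    PolylogWidthMonotoneEasy → ¬ (∀ f : (n : ℕ) → MvPolynomial (Fin n × Fin n) ℂ,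
      (∀ (n : ℕ) (σ τ : Equiv.Perm (Fin n)),
        MvPolynomial.rename (fun p : Fin n × Fin n => (σ p.1, τ p.2)) (f n) = f n) →
      IsVPFamily f →
      ∃ c : ℕ, ∀ n : ℕ, ∃ (G : Type) (_ : Fintype G)
        (C : LabelledArithCircuit ℂ (Fin n × Fin n) Unit G),
        C.IsSymmetric (Equiv.Perm (Fin n)) ∧ C.eval (C.output ()) = f n ∧
          C.orbitSize (Equiv.Perm (Fin n)) ≤ 2 ^ ((Nat.log 2 n + c) ^ c)) := fun h =>
  stub_orbitRestoration_false_of_polylogWidthVP (polylogWidthVP_of_polylogWidthMonotoneEasy h)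

end Summit.ValiantsHypothesis.ValiantsHypothesis.Theorems

end
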